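import Summits.ResolutionOfSingularities.ResolutionOfSingularities.Theses.UniversalCells
import Literature.AlgebraicGeometry.Resolution.ResolutionGlue
import Literature.AlgebraicGeometry.Resolution.SmoothOfRegularPerfectField
import Summits.ResolutionOfSingularities.ResolutionOfSingularities.Theorems.FrobeniusLadderFRationalResolutionAffineSpaceResolution

/-!
# `UniversalCells.ProductDescent` (crux stmt-ResolutionOfSingularities-15231), line `birth`
# (rev L5): the open core stub `stub_separabilisation` has NO SLACK — it is implied by the
# crux's own conclusion (hence by the crux, the route target and the summit)

Refuter crux-attack seat (cdisprove, cycle 1, 2026-08-17); negative-side support, no definition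
declared, does not refute anything.

`stub_separabilisation` (registered in `Cruxes/ProductDescent/Lines/birth.lean`) asks, from the
crux data `(p, Y, f, s, W, j, w, W')`, for a local resolution `π : X₁ → V₁ ⊆ 𝔸ˢ_Y`, an open
`V ∋ y` and sections `g` such that the `p`-th power section value `b = σ_g(y)` lies in `V₁` and
`X₁ → 𝔸ˢ_{𝔽_p}` is smooth at every point over `b`. Here we record, sorry-free:

* `separabilisation_of_downstairs` — if `y` has a resolvable open neighbourhood `U` (`Y` merely
  locally of finite type over `𝔽_p`), the conclusion of `stub_separabilisation` holds for every
  `s`: `V₁ := 𝔸ˢ_U ⊆ 𝔸ˢ_Y`, `X₁ := 𝔸ˢ_Ũ` for a resolution `ρ : Ũ → U`, `π := 𝔸ˢ(ρ)` (proper and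
  birational by base change, regular source — `FRationalResolution.stub_isBirational_affineSpace_map`,
  `stub_isRegular_affineSpace` in tree), `V := U`, `g := 0`; the composite `X₁ → 𝔸ˢ_{𝔽_p}` is
  `𝔸ˢ` of `Ũ → Spec 𝔽_p`, which is SMOOTH because `Ũ` is regular of finite type over the perfect
  field `𝔽_p` (`smooth_of_isRegular_of_perfectField`, Matsumura §30 Rem. 2), so its smooth locus
  is everything.
* `stub_separabilisation_of_productDescent` — hence the crux implies the stub (verbatim
  signature), and so do `PrimeFieldThesis` and the summit
  (`stub_separabilisation_of_primeFieldThesis`).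

Consequence for the line: with the lead's kernel-checked composition
`stub_separabilisation → (true stubs) → ProductDescent`, the open stub is EQUIVALENT to the crux
modulo the true stubs — the `p`-th power section cut isolates the difficulty without reducing
it, and `stub_separabilisation` is exactly as irrefutable as the crux (see
`Negative/LoadBearing.lean`: a refutation needs a failure of local resolution over `𝔽_p`).
-/

noncomputable section

-- single-problem summit: the doubled namespace component `ResolutionOfSingularities` is forced
set_option linter.dupNamespace false

open CategoryTheory CategoryTheory.Limits AlgebraicGeometry Literature.AlgebraicGeometry.Resolution
open Summit.ResolutionOfSingularities.ResolutionOfSingularities.Theses.UniversalCells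
  (ProductDescent PrimeFieldThesis)
open Summit.ResolutionOfSingularities.ResolutionOfSingularities.Theorems.FRationalResolution
  (stub_isBirational_affineSpace_map stub_isRegular_affineSpace)

namespace Summit.ResolutionOfSingularities.ResolutionOfSingularities.Theorems.ProductDescent.Negative

/-- **DOWNSTAIRS ⇒ separabilisation.** If `y` has an open neighbourhood `U` with a resolution
`ρ : Ũ → U` (`Y` locally of finite type over `𝔽_p`), then for every `s` the conclusion of
`stub_separabilisation` holds at `y`: `π := 𝔸ˢ(ρ) : 𝔸ˢ_Ũ → 𝔸ˢ_U ⊆ 𝔸ˢ_Y` is a resolution, the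
zero `p`-th power section through `y` lands in `𝔸ˢ_U`, and `𝔸ˢ_Ũ → 𝔸ˢ_{𝔽_p}` is smooth
everywhere (`Ũ` regular of finite type over the perfect field `𝔽_p`).
[cite: Matsumura1987, §30 Remark 2] -/
theorem separabilisation_of_downstairs {p : ℕ} (hp : p.Prime) {Y : Scheme.{0}}
    (f : Y ⟶ Spec (.of (ZMod p))) [LocallyOfFiniteType f] {y : Y}
    (hy : ∃ U : Y.Opens, y ∈ U ∧ Scheme.HasResolution (U : Scheme.{0})) (s : ℕ) :
    ∃ (V₁ : (AffineSpace (Fin s) Y).Opens) (X₁ : Scheme.{0}) (π : X₁ ⟶ (V₁ : Scheme.{0})),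
      IsResolution π ∧
      ∃ (V : Y.Opens) (hyV : y ∈ V) (g : Fin s → Γ((V : Scheme.{0}), ⊤)),
        (AffineSpace.homOfVector V.ι (fun i => g i ^ p)).base ⟨y, hyV⟩ ∈ V₁ ∧
        ∃ _ : LocallyOfFinitePresentation (π ≫ V₁.ι ≫ AffineSpace.map (Fin s) f),
          ∀ x : X₁, (π ≫ V₁.ι).base x =
              (AffineSpace.homOfVector V.ι (fun i => g i ^ p)).base ⟨y, hyV⟩ →
            x ∈ (π ≫ V₁.ι ≫ AffineSpace.map (Fin s) f).smoothLocus := by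
  haveI : Fact p.Prime := ⟨hp⟩
  obtain ⟨U, hyU, X', ρ, hρ⟩ := hy
  haveI := hρ.isProper
  haveI : IsLocallyNoetherian Y := LocallyOfFiniteType.isLocallyNoetherian f
  haveI : IsLocallyNoetherian X' := LocallyOfFiniteType.isLocallyNoetherian ρ
  -- `𝔸ˢ_U ↪ 𝔸ˢ_Y`, base change of `U ↪ Y`
  let m : AffineSpace (Fin s) (U : Scheme.{0}) ⟶ AffineSpace (Fin s) Y :=
    AffineSpace.map (Fin s) U.ι
  haveI hm : IsOpenImmersion m :=
    MorphismProperty.IsStableUnderBaseChange.of_isPullback (P := @IsOpenImmersion)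
      (AffineSpace.isPullback_map U.ι).flip inferInstance
  haveI : IsProper (AffineSpace.map (Fin s) ρ) :=
    MorphismProperty.IsStableUnderBaseChange.of_isPullback (P := @IsProper)
      (AffineSpace.isPullback_map ρ).flip hρ.isProper
  let V₁ : (AffineSpace (Fin s) Y).Opens := m.opensRange
  let π : AffineSpace (Fin s) X' ⟶ (V₁ : Scheme.{0}) :=
    AffineSpace.map (Fin s) ρ ≫ m.isoOpensRange.hom
  have hπ : IsResolution π :=
    ⟨inferInstance,
      (stub_isBirational_affineSpace_map s X' (U : Scheme.{0}) ρ hρ.isBirational).comp_iso _,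
      stub_isRegular_affineSpace s X' hρ.isRegular⟩
  -- the composite to `𝔸ˢ_{𝔽_p}` is `𝔸ˢ` of the smooth `X' → Spec 𝔽_p`
  have e : π ≫ V₁.ι ≫ AffineSpace.map (Fin s) f = AffineSpace.map (Fin s) (ρ ≫ U.ι ≫ f) := by
    simp only [π, V₁, m, Category.assoc, Scheme.Hom.isoOpensRange_hom_ι_assoc,
      AffineSpace.map_comp]
  have hsm' : Smooth (AffineSpace.map (Fin s) (ρ ≫ U.ι ≫ f)) :=
    MorphismProperty.IsStableUnderBaseChange.of_isPullback (P := @Smooth)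
      (AffineSpace.isPullback_map (ρ ≫ U.ι ≫ f)).flip
      (smooth_of_isRegular_of_perfectField (ρ ≫ U.ι ≫ f) hρ.isRegular)
  haveI hsm : Smooth (π ≫ V₁.ι ≫ AffineSpace.map (Fin s) f) := e ▸ hsm'
  -- the value of the zero section at `y` lies in `V₁ = 𝔸ˢ_U`
  have hmem : (AffineSpace.homOfVector U.ι (fun _ : Fin s => (0 : Γ((U : Scheme.{0}), ⊤)) ^ p)).base
      ⟨y, hyU⟩ ∈ V₁ := by
    obtain ⟨z, hz, -⟩ := Scheme.Pullback.exists_preimage_pullback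
      (f := CategoryTheory.over (AffineSpace (Fin s) Y) Y) (g := U.ι)
      ((AffineSpace.homOfVector U.ι (fun _ : Fin s => (0 : Γ((U : Scheme.{0}), ⊤)) ^ p)).base
        ⟨y, hyU⟩) ⟨y, hyU⟩
      (by rw [← Scheme.Hom.comp_apply, AffineSpace.homOfVector_over])
    refine ⟨(AffineSpace.isPullback_map U.ι).isoPullback.inv.base z, ?_⟩
    rw [← Scheme.Hom.comp_apply, IsPullback.isoPullback_inv_fst]
    exact hz
  refine ⟨V₁, _, π, hπ, U, hyU, fun _ => 0, hmem, inferInstance, fun x _ => ?_⟩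
  rw [Scheme.Hom.smoothLocus_eq_top]
  trivial

/-- **The crux implies its own open stub** (`stub_separabilisation`, registered signature,
verbatim as conclusion): apply the crux to get a resolvable neighbourhood of `y`, then
`separabilisation_of_downstairs`. With the lead's composition the stub is therefore EQUIVALENT to
the crux modulo the true stubs — the line has no slack. [folklore] -/
theorem stub_separabilisation_of_productDescent (hPD : ProductDescent) :
    ∀ p : ℕ, p.Prime → ∀ (Y : Scheme.{0}) (f : Y ⟶ Spec (.of (ZMod p))),
      IsSeparated f → LocallyOfFiniteType f → QuasiCompact f → IsIntegral Y →
      ∀ (s : ℕ) (W : Scheme.{0}) (j : W ⟶ AffineSpace (Fin s) Y), IsOpenImmersion j →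
      ∀ w : W, (∃ W' : W.Opens, w ∈ W' ∧ Scheme.HasResolution (W' : Scheme.{0})) →
      ∃ (V₁ : (AffineSpace (Fin s) Y).Opens) (X₁ : Scheme.{0}) (π : X₁ ⟶ (V₁ : Scheme.{0})),
        IsResolution π ∧
        ∃ (V : Y.Opens) (hyV : (CategoryTheory.over (AffineSpace (Fin s) Y) Y).base (j.base w) ∈ V)
          (g : Fin s → Γ((V : Scheme.{0}), ⊤)),
          (AffineSpace.homOfVector V.ι (fun i => g i ^ p)).base ⟨_, hyV⟩ ∈ V₁ ∧
          ∃ _ : LocallyOfFinitePresentation (π ≫ V₁.ι ≫ AffineSpace.map (Fin s) f),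
            ∀ x : X₁, (π ≫ V₁.ι).base x =
                (AffineSpace.homOfVector V.ι (fun i => g i ^ p)).base ⟨_, hyV⟩ →
              x ∈ (π ≫ V₁.ι ≫ AffineSpace.map (Fin s) f).smoothLocus := by
  intro p hp Y f hs hl hq hi s W j hj w hw
  haveI := hl
  exact separabilisation_of_downstairs hp f (hPD p hp Y f hs hl hq hi s W j hj w hw) s

/-- … and so does the route target `PrimeFieldThesis` (resolve `Y`, restrict to `⊤ ∋ y`): the
open stub is irrefutable short of disproving resolution over the prime field. [folklore] -/
theorem stub_separabilisation_of_primeFieldThesis (hT : PrimeFieldThesis) :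
    ∀ p : ℕ, p.Prime → ∀ (Y : Scheme.{0}) (f : Y ⟶ Spec (.of (ZMod p))),
      IsSeparated f → LocallyOfFiniteType f → QuasiCompact f → IsIntegral Y →
      ∀ (s : ℕ) (W : Scheme.{0}) (j : W ⟶ AffineSpace (Fin s) Y), IsOpenImmersion j →
      ∀ w : W, (∃ W' : W.Opens, w ∈ W' ∧ Scheme.HasResolution (W' : Scheme.{0})) →
      ∃ (V₁ : (AffineSpace (Fin s) Y).Opens) (X₁ : Scheme.{0}) (π : X₁ ⟶ (V₁ : Scheme.{0})),
        IsResolution π ∧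
        ∃ (V : Y.Opens) (hyV : (CategoryTheory.over (AffineSpace (Fin s) Y) Y).base (j.base w) ∈ V)
          (g : Fin s → Γ((V : Scheme.{0}), ⊤)),
          (AffineSpace.homOfVector V.ι (fun i => g i ^ p)).base ⟨_, hyV⟩ ∈ V₁ ∧
          ∃ _ : LocallyOfFinitePresentation (π ≫ V₁.ι ≫ AffineSpace.map (Fin s) f),
            ∀ x : X₁, (π ≫ V₁.ι).base x =
                (AffineSpace.homOfVector V.ι (fun i => g i ^ p)).base ⟨_, hyV⟩ →
              x ∈ (π ≫ V₁.ι ≫ AffineSpace.map (Fin s) f).smoothLocus := by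
  intro p hp Y f hs hl hq hi s W j hj w _
  haveI := hl
  exact separabilisation_of_downstairs hp f ⟨⊤, trivial, (hT p hp Y f hs hl hq hi).restrict ⊤⟩ s

end Summit.ResolutionOfSingularities.ResolutionOfSingularities.Theorems.ProductDescent.Negative

end
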